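import Summits.QuantumAdvantage.QuantumAdvantage.Theorems.NearExactIsExact.Negative.Census10GSide

/-!
# `NearExactIsExact` (stmt-QuantumAdvantage-14043), negative side — the g-side of CENSUS₁₀′ has solutions at FULL rank (`h = 4`)

Block-2b certificate seat `b2b-cforr-cert` (2026-08-18).  HONEST FRAMING: a DECIDABLE VERDICT about the finite census behind the
`n = 10`, `θ = 7/8` rung, NOT summit progress.

`Census10GSide.lean` exhibits a solution of the pure g-side cell system with `Q` of Dickson type `h = 3`.  The crux NOTES (lead c6,
part 4, "CORRECTION") state that for the full-rank type `h = 4` the heavy-both solutions are all killed by the LIGHT cells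
("NSOL = 0").  This file shows that statement is wrong as a statement about the cell system of `isolation_ten_78_of_census`:
with

* `Q₄ = w₀w₁ ⊕ w₂w₃ ⊕ w₄w₅ ⊕ w₆w₇` (bias `+16`), `D₄ = w₀w₄ ⊕ w₁w₂ ⊕ w₆`, `bh = false`,
* `E₄` = the XOR of the 31 monomials `E4monos` (10 quadratic, 21 cubic),

all `2 · 256` heavy cell sums are `≡ 8 (mod 16)` and all `2 · 256` light cell sums are `≡ 4 (mod 8)` (`checkWitnessH4_eq_true`,
one `native_decide` table check on the integer transcription `cellZ` of `Census10GSide.lean`).  It was found by this seat's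
independent census (kit j038490: for `h = 4` there are exactly 36 `(D₂-orbit, λ)` instances with full g-side solutions,
`110 592` cubic `E` modulo gauge in total) and re-verified in plain Python.  What kills it is the f-side only: Reed decoding of
its heavy 9-bit sign word in `RM(3,9)` ties, so no cubic lies within distance `31` and no cubic partner `f₁` has `Φ > 7/8`
(census evidence `CENSUS-REPORT.md`; that part is NOT a Lean theorem).  Axioms: the standard three plus `Lean.ofReduceBool`
(`native_decide`, computational).
-/

set_option linter.dupNamespace false -- D-0017: single-problem summit ⇒ `QuantumAdvantage.QuantumAdvantage` by design

namespace Summit.QuantumAdvantage.QuantumAdvantage.Theorems.NearExactIsExact.Negative.Census10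

open Finset
open Literature.Computability.QuantumComplexity
open Summit.QuantumAdvantage.QuantumAdvantage.Theorems.SignedExactSliceIsLift
open Summit.QuantumAdvantage.QuantumAdvantage.Theorems.SignedExactSliceIsLift.StubMoebius
open Summit.QuantumAdvantage.QuantumAdvantage.Theorems.NearExactIsExact.Negative.SmallCases

/-! ### The full-rank witness -/

/-- The 31 monomials of the cubic `E₄`. [this work, census kit j038490] -/
def E4monos : List (List ℕ) :=
  [[2, 3], [2, 4], [3, 4], [0, 5], [2, 5], [4, 5], [3, 6], [1, 7], [2, 7], [3, 7], [0, 1, 2], [0, 2, 3], [1, 2, 3], [0, 1, 4],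
   [0, 2, 4], [1, 2, 4], [0, 3, 4], [2, 3, 4], [0, 1, 5], [1, 2, 5], [0, 4, 5], [2, 4, 5], [1, 3, 6], [0, 4, 6], [1, 4, 6],
   [3, 4, 6], [3, 5, 6], [4, 5, 6], [0, 3, 7], [3, 4, 7], [1, 5, 7]]

/-- `E₄ = ⊕_{S ∈ E4monos} ∏_{i ∈ S} wᵢ`. [this work] -/
def E₄ (w : Fin 8 → Bool) : Bool := evalMonos 8 E4monos w

/-- `D₄ = w₀w₄ ⊕ w₁w₂ ⊕ w₆`. [this work] -/
def D₄ (w : Fin 8 → Bool) : Bool :=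
  xor (xor ([0, 4].all (litVal 8 w)) ([1, 2].all (litVal 8 w))) ([6].all (litVal 8 w))

/-- `Q₄ = w₀w₁ ⊕ w₂w₃ ⊕ w₄w₅ ⊕ w₆w₇` (Dickson normal form, full rank `h = 4`). [cite: MacWilliamsSloane1977, Ch. 15 §2 Thm. 4] -/
def Q₄ (w : Fin 8 → Bool) : Bool :=
  xor (xor (xor ([0, 1].all (litVal 8 w)) ([2, 3].all (litVal 8 w))) ([4, 5].all (litVal 8 w))) ([6, 7].all (litVal 8 w))

/-- `E₄` is cubic. [cite: Carlet2020, §2.2.1 Def. 6] -/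
theorem isDegLeFun_E₄ : IsDegLeFun 3 E₄ := isDegLeFun_evalMonos E4monos

/-- `D₄` is quadratic. [cite: Carlet2020, §2.2.1 Def. 6] -/
theorem isDegLeFun_D₄ : IsDegLeFun 2 D₄ :=
  isDegLeFun_xor (isDegLeFun_xor (isDegLeFun_all [0, 4]) (isDegLeFun_all [1, 2])) ((isDegLeFun_all [6]).mono (by decide))

/-- `Q₄` is quadratic. [cite: Carlet2020, §2.2.1 Def. 6] -/
theorem isDegLeFun_Q₄ : IsDegLeFun 2 Q₄ :=
  isDegLeFun_xor (isDegLeFun_xor (isDegLeFun_xor (isDegLeFun_all [0, 1]) (isDegLeFun_all [2, 3])) (isDegLeFun_all [4, 5]))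
    (isDegLeFun_all [6, 7])

/-- The bias of `Q₄` on codes. [folklore] -/
theorem bias_sum_eq_H4 : (∑ w : Fin (4 + 4) → Bool, signOf (Q₄ w)) = ((∑ k ∈ range 256, sgnZ (Q₄ (pt 8 k)) : ℤ) : ℝ) := by
  rw [sum_pt 8]
  push_cast
  exact sum_congr rfl fun k _ => signOf_eq_cast _

/-- The bias of `Q₄` is `16`. [this work] -/
theorem biasZ_eq_H4 : (∑ k ∈ range 256, sgnZ (Q₄ (pt 8 k))) = 16 := by
  decide +kernel

/-- The finite check for the full-rank witness: heavy cells (`Q₄ = false`) have all sums `≡ 8 (mod 16)`, light cells all sums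
`≡ 4 (mod 8)`. [this work] -/
def checkWitnessH4 : Bool :=
  (List.range 256).all fun y =>
    ([false, true].all fun a => cellZ E₄ D₄ Q₄ a false y % 16 == 8) &&
    ([false, true].all fun a => cellZ E₄ D₄ Q₄ a true y % 8 == 4)

/-- The table check passes (native evaluation of `2 · 2 · 256` integer cell sums). [this work, computational] -/
theorem checkWitnessH4_eq_true : checkWitnessH4 = true := by
  native_decide

/-- Heavy cells of the full-rank witness: every sum is `8·(odd)`. [this work] -/
theorem heavy_witness_H4 (a : Bool) (x : Fin (4 + 4) → Bool) :
    ∃ k : ℤ, (∑ w : Fin (4 + 4) → Bool, if (D₄ w = a ∧ Q₄ w = false) then signOf (E₄ w) * twist w x else 0) =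
      8 * (2 * (k : ℝ) + 1) := by
  obtain ⟨y, hy, rfl⟩ : ∃ y, y < 256 ∧ x = pt 8 y := ⟨codeOf x, codeOf_lt x, (pt_codeOf x).symm⟩
  have h := checkWitnessH4_eq_true
  simp only [checkWitnessH4, List.all_eq_true, Bool.and_eq_true, List.mem_range] at h
  have hmod : cellZ E₄ D₄ Q₄ a false y % 16 = 8 := by
    have := (h y hy).1 a (by cases a <;> simp)
    simpa using this
  refine ⟨cellZ E₄ D₄ Q₄ a false y / 16, ?_⟩
  rw [cell_sum_eq]
  have e : cellZ E₄ D₄ Q₄ a false y = 8 + 16 * (cellZ E₄ D₄ Q₄ a false y / 16) := by omega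
  have e' : (cellZ E₄ D₄ Q₄ a false y : ℝ) = 8 + 16 * ((cellZ E₄ D₄ Q₄ a false y / 16 : ℤ) : ℝ) := by exact_mod_cast e
  rw [e']
  ring

/-- Light cells of the full-rank witness: every sum is `4·(odd)`. [this work] -/
theorem light_witness_H4 (a : Bool) (x : Fin (4 + 4) → Bool) :
    ∃ k : ℤ, (∑ w : Fin (4 + 4) → Bool, if (D₄ w = a ∧ Q₄ w = !false) then signOf (E₄ w) * twist w x else 0) =
      4 * (2 * (k : ℝ) + 1) := by
  obtain ⟨y, hy, rfl⟩ : ∃ y, y < 256 ∧ x = pt 8 y := ⟨codeOf x, codeOf_lt x, (pt_codeOf x).symm⟩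
  have h := checkWitnessH4_eq_true
  simp only [checkWitnessH4, List.all_eq_true, Bool.and_eq_true, List.mem_range] at h
  have hmod : cellZ E₄ D₄ Q₄ a true y % 8 = 4 := by
    have := (h y hy).2 a (by cases a <;> simp)
    simpa using this
  refine ⟨cellZ E₄ D₄ Q₄ a true y / 8, ?_⟩
  rw [show (!false) = true from rfl, cell_sum_eq]
  have e : cellZ E₄ D₄ Q₄ a true y = 4 + 8 * (cellZ E₄ D₄ Q₄ a true y / 8) := by omega
  have e' : (cellZ E₄ D₄ Q₄ a true y : ℝ) = 4 + 8 * ((cellZ E₄ D₄ Q₄ a true y / 8 : ℤ) : ℝ) := by exact_mod_cast e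
  rw [e']
  ring

/-- The bias of `Q₄` is nonzero and `< 128` in absolute value. [this work] -/
theorem bias_witness_H4 :
    (∑ w : Fin (4 + 4) → Bool, signOf (Q₄ w)) ≠ 0 ∧ |∑ w : Fin (4 + 4) → Bool, signOf (Q₄ w)| < 128 := by
  rw [bias_sum_eq_H4, biasZ_eq_H4]
  norm_num

/-- `D₄` is not affine (it has the quadratic monomial `w₀w₄`): the witness lies outside the family excluded by
`census10_no_affine_D`.  Stated as a concrete non-affineness: `D₄(0) ⊕ D₄(e₀) ⊕ D₄(e₄) ⊕ D₄(e₀+e₄) = 1`. [this work] -/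
theorem D₄_second_derivative :
    (D₄ (fun _ => false) ^^ D₄ (fun i => decide (i = 0)) ^^ D₄ (fun i => decide (i = 4)) ^^
      D₄ (fun i => decide (i = 0) || decide (i = 4))) = true := by
  decide

/-- **A full-rank solution of the pure g-side cell system.** `(E₄, D₄, Q₄, false)` — `Q₄` of Dickson type `h = 4` —
satisfies every hypothesis of the finite proposition CENSUS₁₀ of `isolation_ten_78_of_census`; so g-side solutions are not
confined to the degenerate Dickson types, and for `h = 4` the light cells do NOT kill all heavy-both solutions (contrary to the
crux NOTES, lead c6 part 4).  Only the f-side (no cubic within Hamming distance 31 of the heavy sign word; census evidence, not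
a Lean theorem) excludes a partner. [this work, census kit j038490] -/
theorem census10_gside_solution_fullRank :
    ∃ (E D Q : (Fin (4 + 4) → Bool) → Bool) (bh : Bool), IsDegLeFun 3 E ∧ IsDegLeFun 2 D ∧ IsDegLeFun 2 Q ∧
      (∑ w, signOf (Q w)) = 16 ∧
      (∀ (a : Bool) (x : Fin (4 + 4) → Bool), ∃ k : ℤ,
        (∑ w : Fin (4 + 4) → Bool, if (D w = a ∧ Q w = bh) then signOf (E w) * twist w x else 0) = 8 * (2 * (k : ℝ) + 1)) ∧
      (∀ (a : Bool) (x : Fin (4 + 4) → Bool), ∃ k : ℤ,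
        (∑ w : Fin (4 + 4) → Bool, if (D w = a ∧ Q w = !bh) then signOf (E w) * twist w x else 0) = 4 * (2 * (k : ℝ) + 1)) :=
  ⟨E₄, D₄, Q₄, false, isDegLeFun_E₄, isDegLeFun_D₄, isDegLeFun_Q₄, by rw [bias_sum_eq_H4, biasZ_eq_H4]; norm_num,
    heavy_witness_H4, light_witness_H4⟩

end Summit.QuantumAdvantage.QuantumAdvantage.Theorems.NearExactIsExact.Negative.Census10
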